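import Summits.BirchSwinnertonDyer.Rank1Residual.ManinAdditive.SigmaEtaKummer
import Mathlib.RingTheory.ZMod.UnitsCyclic
import Mathlib.Data.Nat.Factorization.Induction
import Mathlib.NumberTheory.LegendreSymbol.QuadraticChar.Basic
import HarnessLib

/-!
# Real characters of `(ℤ/m)ˣ` are `χ₄^a · χ₈^b · (·/q)` — the group-theoretic core of E-an-158 (an g35, T-an-38, file D part 1/2)

TYPER NOTE (typer g19, TURNKEY T-an-38, part 1/2 of file D).  SOURCE = HOME/an/g35/ShimuraKronecker-an-g35.lean sha16 7905f4c0102aadb4 (519 l.;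
an: farm rc 0 · 0 err · 0 warn, axioms standard), lines 23–320 (= an's namespace `ShimuraKroneckerCore`) VERBATIM except: this note; the bare
top-level namespace `ShimuraKroneckerCore` renamed `Summit.BirchSwinnertonDyer.Rank1Residual.ManinAdditive.ShimuraKroneckerCore` (tree namespace convention:
summit-side declarations live under `Summit.<Summit>…`); one-line docstrings on seven undocumented helper lemmas.  SPLIT for the 400-line cap:
part 2 `ShimuraKronecker.lean` = an's lines 322–519 (`SigmaEta.shimuraTwoCharIsKronecker`, E-an-158 spelled out).  CONTENT (an's words):
`realUnitChar_classification (m) : ∀ f : (ZMod m)ˣ →* ℤˣ, ∃ q a b, Squarefree q ∧ Odd q ∧ q ∣ m ∧ a ≤ 1 ∧ b ≤ 1 ∧ (a = 1 → 4 ∣ m) ∧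
(b = 1 → 8 ∣ m) ∧ ∀ d (hd : d.Coprime m), (f (unitOfCoprime d hd) : ℤ) = χ₄ d ^ a * χ₈ d ^ b * J(d ∣ q)` — CRT induction
`Nat.recOnPrimeCoprime`; odd prime powers via cyclicity of `(ZMod p^k)ˣ` and the lifted Legendre character (`local_odd`); `2`-powers via Hensel at
`2` (`exists_odd_sq_sub_dvd_two_pow`, `local_two`); `liftLeft`/`liftRight` + `unitOfCoprime_eq_liftLeft_mul_liftRight` (CRT).  A classical
fact (real Dirichlet characters are Kronecker symbols) proved here from Mathlib, not vendored as a Literature fact; imports = an's.  Two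
`noncomputable def`s (`liftLeft`, `liftRight`), otherwise theorems; nothing conjectured.  PARTITION 0 · beyond-print theorem: no (classical) ·
BSD / C2 / Manin `c = 1` NOT proved by this.
-/

namespace Summit.BirchSwinnertonDyer.Rank1Residual.ManinAdditive.ShimuraKroneckerCore

open ZMod
open scoped NumberTheorySymbols

/-- Hensel at `2`: `u ≡ 1 (mod 8)` is an odd square modulo every `2^k`. -/
theorem exists_odd_sq_sub_dvd_two_pow (u : ℤ) (hu : u % 8 = 1) (k : ℕ) :
    ∃ y : ℤ, Odd y ∧ (2 : ℤ) ^ k ∣ y * y - u := by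
  induction k with
  | zero => exact ⟨1, odd_one, by simp⟩
  | succ k ih =>
    by_cases hk : k + 1 ≤ 3
    · refine ⟨1, odd_one, (pow_dvd_pow 2 hk).trans ?_⟩
      have h8 : (8 : ℤ) ∣ 1 * 1 - u := by omega
      simpa using h8
    · obtain ⟨y, hy, t, ht⟩ := ih
      obtain ⟨j, rfl⟩ : ∃ j, k = j + 3 := ⟨k - 3, by omega⟩
      rcases Int.even_or_odd t with ⟨s, hs⟩ | ht1
      · exact ⟨y, hy, s, by rw [ht, hs]; ring⟩
      · obtain ⟨w, hw⟩ : ∃ w : ℤ, t + y = 2 * w := by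
          obtain ⟨s, hs⟩ := ht1
          obtain ⟨y', hy'⟩ := hy
          exact ⟨s + y' + 1, by rw [hs, hy']; ring⟩
        refine ⟨y + 2 ^ (j + 2), hy.add_even (Int.even_pow.mpr ⟨even_two, by omega⟩), w + 2 ^ j, ?_⟩
        linear_combination ht + 2 ^ (j + 3) * hw

/-- `ZMod.unitOfCoprime` depends only on the residue class: `d ≡ d' (mod m)` give the same unit. -/
theorem unitOfCoprime_congr {m d d' : ℕ} (hd : d.Coprime m) (hd' : d'.Coprime m) (h : d ≡ d' [MOD m]) :
    unitOfCoprime d hd = unitOfCoprime d' hd' :=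
  Units.ext (by rw [coe_unitOfCoprime, coe_unitOfCoprime]; exact (natCast_eq_natCast_iff _ _ _).mpr h)

/-- `ZMod.unitOfCoprime` is multiplicative. -/
theorem unitOfCoprime_mul {m d d' : ℕ} (hd : d.Coprime m) (hd' : d'.Coprime m) (hdd' : (d * d').Coprime m) :
    unitOfCoprime (d * d') hdd' = unitOfCoprime d hd * unitOfCoprime d' hd' :=
  Units.ext (by rw [Units.val_mul, coe_unitOfCoprime, coe_unitOfCoprime, coe_unitOfCoprime, Nat.cast_mul])

/-- `ZMod.unitOfCoprime 1 = 1`. -/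
theorem unitOfCoprime_one {m : ℕ} (h : (1 : ℕ).Coprime m) : unitOfCoprime 1 h = 1 :=
  Units.ext (by rw [coe_unitOfCoprime, Nat.cast_one, Units.val_one])

/-- Every unit of `ℤ` squares to `1`. -/
theorem units_int_mul_self (e : ℤˣ) : e * e = 1 := by
  rcases Int.units_eq_one_or e with rfl | rfl <;> simp

/-- A real character of `(ℤ/2^k)ˣ` depends only on `d mod 8`. -/
theorem hom_units_two_pow_mod_eight {k : ℕ} (f : (ZMod (2 ^ k))ˣ →* ℤˣ) {d d' : ℕ}
    (hd : d.Coprime (2 ^ k)) (hd' : d'.Coprime (2 ^ k)) (h : d % 8 = d' % 8) :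
    f (unitOfCoprime d hd) = f (unitOfCoprime d' hd') := by
  by_cases hk : k ≤ 3
  · have h8 : 2 ^ k ∣ 8 := by simpa using Nat.pow_dvd_pow 2 hk
    rw [unitOfCoprime_congr hd hd' ((Nat.ModEq.of_dvd h8) h)]
  · replace hk : 3 ≤ k := by omega
    haveI : NeZero (2 ^ k) := ⟨by positivity⟩
    have h8 : 8 ∣ 2 ^ k := by simpa using Nat.pow_dvd_pow 2 hk
    have h1 : 1 < 2 ^ k := Nat.one_lt_two_pow (by omega)
    obtain ⟨i, -, hi⟩ := Nat.exists_mul_mod_eq_one_of_coprime hd h1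
    have hmod : d * i ≡ 1 [MOD 2 ^ k] := hi.trans (Nat.mod_eq_of_lt h1).symm
    have hw8 : (d' * i) % 8 = 1 := by
      have h₁ : d' * i ≡ d * i [MOD 8] := Nat.ModEq.mul_right i h.symm
      have h₂ : d * i ≡ 1 [MOD 8] := Nat.ModEq.of_dvd h8 hmod
      exact h₁.trans h₂
    obtain ⟨y, hy, hyw⟩ := exists_odd_sq_sub_dvd_two_pow (d' * i : ℕ) (by exact_mod_cast hw8) k
    have hn_odd : Odd y.natAbs := Int.natAbs_odd.mpr hy
    have hn_cop : y.natAbs.Coprime (2 ^ k) := (Nat.coprime_two_right.mpr hn_odd).pow_right k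
    have e2 : ((y * y : ℤ) : ZMod (2 ^ k)) = ((d' * i : ℕ) : ZMod (2 ^ k)) := by
      have h0 : (((y * y - (d' * i : ℕ) : ℤ)) : ZMod (2 ^ k)) = 0 := by
        rw [ZMod.intCast_zmod_eq_zero_iff_dvd]; push_cast; exact hyw
      rwa [Int.cast_sub, sub_eq_zero, Int.cast_natCast] at h0
    have hsq : ((y.natAbs : ℕ) : ZMod (2 ^ k)) * y.natAbs = ((d' * i : ℕ) : ZMod (2 ^ k)) := by
      rw [← Nat.cast_mul, ← Int.cast_natCast (y.natAbs * y.natAbs), Int.natAbs_mul_self, e2]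
    have hcast1 : (d : ZMod (2 ^ k)) * (i : ZMod (2 ^ k)) = 1 := by
      have := (ZMod.natCast_eq_natCast_iff _ _ _).mpr hmod
      rwa [Nat.cast_mul, Nat.cast_one] at this
    have hu : unitOfCoprime d' hd' =
        unitOfCoprime d hd * unitOfCoprime y.natAbs hn_cop * unitOfCoprime y.natAbs hn_cop := by
      apply Units.ext
      simp only [Units.val_mul, coe_unitOfCoprime]
      symm
      rw [mul_assoc, hsq, Nat.cast_mul, mul_left_comm, hcast1, mul_one]
    rw [hu, map_mul, map_mul, mul_assoc, units_int_mul_self, mul_one]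

/-- LOCAL CLASSIFICATION AT `2`: a real character of `(ℤ/2^k)ˣ` is `d ↦ χ₄(d)^a χ₈(d)^b`. -/
theorem local_two (k : ℕ) (f : (ZMod (2 ^ k))ˣ →* ℤˣ) :
    ∃ a b : ℕ, a ≤ 1 ∧ b ≤ 1 ∧ (a = 1 → 4 ∣ 2 ^ k) ∧ (b = 1 → 8 ∣ 2 ^ k) ∧
      ∀ (d : ℕ) (hd : d.Coprime (2 ^ k)), ((f (unitOfCoprime d hd) : ℤˣ) : ℤ) = χ₄ d ^ a * χ₈ d ^ b := by
  rcases Nat.eq_zero_or_pos k with rfl | hk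
  · refine ⟨0, 0, zero_le_one, zero_le_one, by simp, by simp, fun d hd => ?_⟩
    have hs : Subsingleton (ZMod (2 ^ 0)) := ZMod.subsingleton_iff.mpr (pow_zero 2)
    have : unitOfCoprime d hd = 1 := Units.ext (Subsingleton.elim _ _)
    rw [this, map_one]; simp
  have h3 : (3 : ℕ).Coprime (2 ^ k) := Nat.Coprime.pow_right k (by norm_num)
  have h5 : (5 : ℕ).Coprime (2 ^ k) := Nat.Coprime.pow_right k (by norm_num)
  have h15 : (15 : ℕ).Coprime (2 ^ k) := Nat.Coprime.pow_right k (by norm_num)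
  have h1 : (1 : ℕ).Coprime (2 ^ k) := Nat.coprime_one_left _
  set ε₃ := f (unitOfCoprime 3 h3) with hε₃
  set ε₅ := f (unitOfCoprime 5 h5) with hε₅
  have hk1 : k < 2 → ε₃ = 1 ∧ ε₅ = 1 := by
    intro hk1
    have h2 : 2 ^ k ∣ 2 := by simpa using Nat.pow_dvd_pow 2 (show k ≤ 1 by omega)
    constructor
    · rw [hε₃, unitOfCoprime_congr h3 h1 (Nat.ModEq.of_dvd h2 (by decide : 3 ≡ 1 [MOD 2])),
        unitOfCoprime_one, map_one]
    · rw [hε₅, unitOfCoprime_congr h5 h1 (Nat.ModEq.of_dvd h2 (by decide : 5 ≡ 1 [MOD 2])),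
        unitOfCoprime_one, map_one]
  have hk2 : k ≤ 2 → ε₅ = 1 := by
    intro hk2
    have h4 : 2 ^ k ∣ 4 := by simpa using Nat.pow_dvd_pow 2 hk2
    rw [hε₅, unitOfCoprime_congr h5 h1 (Nat.ModEq.of_dvd h4 (by decide : 5 ≡ 1 [MOD 4])), unitOfCoprime_one,
      map_one]
  refine ⟨if (ε₃ : ℤ) * (ε₅ : ℤ) = 1 then 0 else 1, if (ε₅ : ℤ) = 1 then 0 else 1, by split_ifs <;> simp,
    by split_ifs <;> simp, ?_, ?_, fun d hd => ?_⟩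
  · intro ha
    have hk2' : 2 ≤ k := by
      rcases Nat.lt_or_ge k 2 with hlt | hge
      · obtain ⟨e3, e5⟩ := hk1 hlt
        rw [e3, e5] at ha
        simp at ha
      · exact hge
    simpa using Nat.pow_dvd_pow 2 hk2'
  · intro hb
    have hk3 : 3 ≤ k := by
      rcases Nat.lt_or_ge k 3 with hlt | hge
      · rw [hk2 (by omega)] at hb
        simp at hb
      · exact hge
    simpa using Nat.pow_dvd_pow 2 hk3
  · have hd2 : d % 2 = 1 := by
      have := Nat.Coprime.coprime_dvd_right (dvd_pow_self 2 hk.ne') hd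
      exact Nat.odd_iff.mp (Nat.coprime_two_right.mp this)
    have hr : d % 8 = 1 ∨ d % 8 = 3 ∨ d % 8 = 5 ∨ d % 8 = 7 := by omega
    rw [ZMod.χ₄_nat_eq_if_mod_four, ZMod.χ₈_nat_eq_if_mod_eight]
    rcases hr with h8 | h8 | h8 | h8
    · have hv : f (unitOfCoprime d hd) = 1 := by
        rw [hom_units_two_pow_mod_eight f hd h1 (by omega), unitOfCoprime_one, map_one]
      have hd4 : d % 4 = 1 := by omega
      rw [hv]; simp [hd2, hd4, h8]
    · have hv : f (unitOfCoprime d hd) = ε₃ := hom_units_two_pow_mod_eight f hd h3 (by omega)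
      have hd4 : d % 4 = 3 := by omega
      rw [hv]
      simp only [hd2, hd4, h8]
      rcases Int.units_eq_one_or ε₃ with e3 | e3 <;> rcases Int.units_eq_one_or ε₅ with e5 | e5 <;>
        simp [e3, e5]
    · have hv : f (unitOfCoprime d hd) = ε₅ := hom_units_two_pow_mod_eight f hd h5 (by omega)
      have hd4 : d % 4 = 1 := by omega
      rw [hv]
      simp only [hd2, hd4, h8]
      rcases Int.units_eq_one_or ε₃ with e3 | e3 <;> rcases Int.units_eq_one_or ε₅ with e5 | e5 <;>
        simp [e3, e5]
    · have hv : f (unitOfCoprime d hd) = ε₃ * ε₅ := by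
        rw [hom_units_two_pow_mod_eight f hd h15 (by omega),
          show unitOfCoprime 15 h15 = unitOfCoprime (3 * 5) h15 from rfl, unitOfCoprime_mul h3 h5, map_mul]
      have hd4 : d % 4 = 3 := by omega
      rw [hv]
      simp only [hd2, hd4, h8]
      rcases Int.units_eq_one_or ε₃ with e3 | e3 <;> rcases Int.units_eq_one_or ε₅ with e5 | e5 <;>
        simp [e3, e5]

/-! ### Odd prime powers: a real character of `(ℤ/p^k)ˣ` is trivial or the Legendre symbol -/

/-- LOCAL CLASSIFICATION AT ODD `p`. -/
theorem local_odd {p : ℕ} (hp : p.Prime) (hp2 : p ≠ 2) (k : ℕ) (f : (ZMod (p ^ k))ˣ →* ℤˣ) :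
    ∃ q : ℕ, (q = 1 ∨ (q = p ∧ 0 < k)) ∧
      ∀ (d : ℕ) (hd : d.Coprime (p ^ k)), ((f (unitOfCoprime d hd) : ℤˣ) : ℤ) = J(d | q) := by
  rcases Nat.eq_zero_or_pos k with rfl | hk
  · refine ⟨1, Or.inl rfl, fun d hd => ?_⟩
    have hs : Subsingleton (ZMod (p ^ 0)) := ZMod.subsingleton_iff.mpr (pow_zero p)
    have : unitOfCoprime d hd = 1 := Units.ext (Subsingleton.elim _ _)
    rw [this, map_one, jacobiSym.one_right, Units.val_one]
  haveI : Fact p.Prime := ⟨hp⟩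
  haveI : NeZero (p ^ k) := ⟨pow_ne_zero _ hp.ne_zero⟩
  have hpk : p ∣ p ^ k := dvd_pow_self p hk.ne'
  haveI : IsCyclic (ZMod (p ^ k))ˣ := ZMod.isCyclic_units_of_prime_pow p hp hp2 k
  obtain ⟨g, hg⟩ := IsCyclic.exists_generator (α := (ZMod (p ^ k))ˣ)
  set L : (ZMod (p ^ k))ˣ →* ℤˣ := (quadraticChar (ZMod p)).toUnitHom.comp (ZMod.unitsMap hpk) with hL
  have hLval : ∀ (d : ℕ) (hd : d.Coprime (p ^ k)), ((L (unitOfCoprime d hd) : ℤˣ) : ℤ) = J(d | p) := by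
    intro d hd
    rw [hL, MonoidHom.comp_apply, MulChar.coe_toUnitHom, ZMod.unitsMap_def, Units.coe_map, coe_unitOfCoprime,
      MonoidHom.coe_coe, ZMod.castHom_apply, ZMod.cast_natCast hpk, ← jacobiSym.legendreSym.to_jacobiSym,
      legendreSym, Int.cast_natCast]
  have hLne : ∃ v : (ZMod (p ^ k))ˣ, L v = -1 := by
    obtain ⟨a, ha⟩ := quadraticChar_exists_neg_one (F := ZMod p) (by rw [ZMod.ringChar_zmod_n]; exact hp2)
    have ha0 : a ≠ 0 := by rintro rfl; simp at ha
    obtain ⟨v, hv⟩ := ZMod.unitsMap_surjective hpk (Units.mk0 a ha0)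
    refine ⟨v, Units.ext ?_⟩
    rw [hL, MonoidHom.comp_apply, MulChar.coe_toUnitHom, hv, Units.val_mk0, ha, Units.val_neg, Units.val_one]
  rcases Int.units_eq_one_or (f g) with hfg | hfg
  · refine ⟨1, Or.inl rfl, fun d hd => ?_⟩
    have : f (unitOfCoprime d hd) = 1 := by
      obtain ⟨z, hz⟩ := Subgroup.mem_zpowers_iff.mp (hg (unitOfCoprime d hd))
      rw [← hz, map_zpow, hfg, one_zpow]
    rw [this, jacobiSym.one_right, Units.val_one]
  · refine ⟨p, Or.inr ⟨rfl, hk⟩, fun d hd => ?_⟩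
    have hLg : L g = -1 := by
      rcases Int.units_eq_one_or (L g) with h1 | h1
      · exfalso
        obtain ⟨v, hv⟩ := hLne
        obtain ⟨z, hz⟩ := Subgroup.mem_zpowers_iff.mp (hg v)
        rw [← hz, map_zpow, h1, one_zpow] at hv
        exact absurd hv (by decide)
      · exact h1
    have : f (unitOfCoprime d hd) = L (unitOfCoprime d hd) := by
      obtain ⟨z, hz⟩ := Subgroup.mem_zpowers_iff.mp (hg (unitOfCoprime d hd))
      rw [← hz, map_zpow, map_zpow, hfg, hLg]
    rw [this, hLval]

/-! ### Chinese remainder step and the global classification -/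

/-- The embedding `(ℤ/a)ˣ → (ℤ/ab)ˣ`, `u ↦ (u, 1)` for coprime `a, b`. -/
noncomputable def liftLeft {a b : ℕ} (hab : a.Coprime b) : (ZMod a)ˣ →* (ZMod (a * b))ˣ :=
  Units.map (((ZMod.chineseRemainder hab).symm.toRingHom.toMonoidHom).comp (MonoidHom.inl (ZMod a) (ZMod b)))

/-- The embedding `(ℤ/b)ˣ → (ℤ/ab)ˣ`, `v ↦ (1, v)` for coprime `a, b`. -/
noncomputable def liftRight {a b : ℕ} (hab : a.Coprime b) : (ZMod b)ˣ →* (ZMod (a * b))ˣ :=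
  Units.map (((ZMod.chineseRemainder hab).symm.toRingHom.toMonoidHom).comp (MonoidHom.inr (ZMod a) (ZMod b)))

/-- The value of `liftLeft` in `ZMod (a*b)`: the CRT element with components `(u, 1)`. -/
theorem val_liftLeft {a b : ℕ} (hab : a.Coprime b) (u : (ZMod a)ˣ) :
    ((liftLeft hab u : (ZMod (a * b))ˣ) : ZMod (a * b)) = (ZMod.chineseRemainder hab).symm ((u : ZMod a), 1) := by
  simp [liftLeft]

/-- The value of `liftRight` in `ZMod (a*b)`: the CRT element with components `(1, v)`. -/
theorem val_liftRight {a b : ℕ} (hab : a.Coprime b) (v : (ZMod b)ˣ) :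
    ((liftRight hab v : (ZMod (a * b))ˣ) : ZMod (a * b)) = (ZMod.chineseRemainder hab).symm (1, (v : ZMod b)) := by
  simp [liftRight]

/-- CRT factorisation of the unit of `d` modulo `a*b` as `liftLeft (d mod a) * liftRight (d mod b)`. -/
theorem unitOfCoprime_eq_liftLeft_mul_liftRight {a b : ℕ} (hab : a.Coprime b) (d : ℕ) (hd : d.Coprime (a * b)) :
    unitOfCoprime d hd =
      liftLeft hab (unitOfCoprime d (hd.coprime_dvd_right (dvd_mul_right a b))) *
        liftRight hab (unitOfCoprime d (hd.coprime_dvd_right (dvd_mul_left b a))) := by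
  apply Units.ext
  rw [Units.val_mul, val_liftLeft, val_liftRight, coe_unitOfCoprime, coe_unitOfCoprime, coe_unitOfCoprime,
    ← map_mul, Prod.mk_mul_mk, mul_one, one_mul]
  have : ((d : ZMod a), (d : ZMod b)) = ((d : ℕ) : ZMod a × ZMod b) := Prod.ext (by simp) (by simp)
  rw [this, map_natCast]

/-- GLOBAL CLASSIFICATION: every real character of `(ℤ/m)ˣ` is `d ↦ χ₄(d)^a χ₈(d)^b (d/q)` with
`q` odd squarefree dividing `m`, `a, b ≤ 1`, `a = 1 → 4 ∣ m`, `b = 1 → 8 ∣ m`. -/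
theorem realUnitChar_classification (m : ℕ) :
    ∀ f : (ZMod m)ˣ →* ℤˣ, ∃ q a b : ℕ, Squarefree q ∧ Odd q ∧ q ∣ m ∧ a ≤ 1 ∧ b ≤ 1 ∧
      (a = 1 → 4 ∣ m) ∧ (b = 1 → 8 ∣ m) ∧
      ∀ (d : ℕ) (hd : d.Coprime m),
        ((f (unitOfCoprime d hd) : ℤˣ) : ℤ) = χ₄ d ^ a * χ₈ d ^ b * J(d | q) := by
  induction m using Nat.recOnPrimeCoprime with
  | zero =>
    intro f
    refine ⟨1, 0, 0, squarefree_one, odd_one, one_dvd _, zero_le_one, zero_le_one, by simp, by simp,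
      fun d hd => ?_⟩
    have hd1 : d = 1 := by have h := Nat.Coprime.gcd_eq_one hd; rwa [Nat.gcd_zero_right] at h
    subst hd1
    rw [unitOfCoprime_one, map_one, Units.val_one, pow_zero, pow_zero, Nat.cast_one, jacobiSym.one_right,
      mul_one, mul_one]
  | prime_pow p n hp =>
    intro f
    by_cases hp2 : p = 2
    · subst hp2
      obtain ⟨a, b, ha, hb, h4, h8, hf⟩ := local_two n f
      exact ⟨1, a, b, squarefree_one, odd_one, one_dvd _, ha, hb, h4, h8, fun d hd => by
        rw [hf d hd, jacobiSym.one_right, mul_one]⟩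
    · obtain ⟨q, hq, hf⟩ := local_odd hp hp2 n f
      refine ⟨q, 0, 0, ?_, ?_, ?_, zero_le_one, zero_le_one, by simp, by simp, fun d hd => by
        rw [hf d hd, pow_zero, pow_zero, one_mul, one_mul]⟩
      · rcases hq with rfl | ⟨rfl, _⟩
        · exact squarefree_one
        · exact hp.prime.squarefree
      · rcases hq with rfl | ⟨rfl, _⟩
        · exact odd_one
        · exact hp.odd_of_ne_two hp2
      · rcases hq with rfl | ⟨rfl, hn⟩
        · exact one_dvd _
        · exact dvd_pow_self q hn.ne'
  | coprime a b ha hb hab iha ihb =>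
    intro f
    obtain ⟨qa, aa, ba, hsqa, hoa, hqa, haa, hba, h4a, h8a, hfa⟩ := iha (f.comp (liftLeft hab))
    obtain ⟨qb, ab, bb, hsqb, hob, hqb, hab', hbb, h4b, h8b, hfb⟩ := ihb (f.comp (liftRight hab))
    have hnot4 : ¬ (4 ∣ a ∧ 4 ∣ b) := by
      rintro ⟨h1, h2⟩
      have := Nat.dvd_gcd h1 h2
      rw [hab] at this
      omega
    have hqcop : qa.Coprime qb :=
      Nat.Coprime.coprime_dvd_left hqa (Nat.Coprime.coprime_dvd_right hqb hab)
    refine ⟨qa * qb, aa + ab, ba + bb, (Nat.squarefree_mul hqcop).mpr ⟨hsqa, hsqb⟩, hoa.mul hob,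
      mul_dvd_mul hqa hqb, ?_, ?_, ?_, ?_, fun d hd => ?_⟩
    · rcases Nat.lt_or_ge (aa + ab) 2 with h | h
      · omega
      · exact absurd ⟨h4a (by omega), h4b (by omega)⟩ hnot4
    · rcases Nat.lt_or_ge (ba + bb) 2 with h | h
      · omega
      · exfalso
        exact hnot4 ⟨(show (4 : ℕ) ∣ 8 by norm_num).trans (h8a (by omega)),
          (show (4 : ℕ) ∣ 8 by norm_num).trans (h8b (by omega))⟩
    · intro h1
      rcases Nat.eq_zero_or_pos aa with h0 | h0
      · exact (h4b (by omega)).mul_left a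
      · exact (h4a (by omega)).mul_right b
    · intro h1
      rcases Nat.eq_zero_or_pos ba with h0 | h0
      · exact (h8b (by omega)).mul_left a
      · exact (h8a (by omega)).mul_right b
    · rw [unitOfCoprime_eq_liftLeft_mul_liftRight hab d hd, map_mul, Units.val_mul, ← MonoidHom.comp_apply,
        ← MonoidHom.comp_apply, hfa, hfb, jacobiSym.mul_right' _ hsqa.ne_zero hsqb.ne_zero, pow_add, pow_add]
      ring

end Summit.BirchSwinnertonDyer.Rank1Residual.ManinAdditive.ShimuraKroneckerCore
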